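import Summits.BirchSwinnertonDyer.BirchSwinnertonDyer.Theses.TorsionLayerDescent
import Summits.BirchSwinnertonDyer.Rank1Residual.X9.TorsionDepthCoprimeClassNumber
import HarnessLib

/-!
# BC5 / T3 witness rung BY ID for route `TorsionLayerDescent` (deciding crux
# stmt-BirchSwinnertonDyer-25546 `HowardContainmentAnyClassNumberOfPrint`): the `p ∤ h_K` slice

HONEST FRAMING (tribunal-w seat `bsd-trib-w-tld`, cell `run/shared/lean/pub/bsd-print-x9/`; D-0033 T3,
`docs/architecture/tribunal.md` §T3). The route's deciding crux is
`HowardContainmentAnyClassNumberOfPrint := MastellaZermanHowardDivisibility →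
CGLSHowardDivisibilityLocalized → AnticyclotomicTowerInRingClassFields → HowardContainmentAnyClassNumber`
(Howard's Theorem-B containment `I(ℋ_∞)² ⊆ char_Λ(X_tors)` at EVERY X9 Heegner frame, NO hypothesis on
the class number `h_K`, GRANTED by name the three printed inputs). This file states and proves, in the
LETTER of that crux (same binders, same carriers, same `∃ jbar D F X` conclusion), its SLICE at the frames
with `p ∤ h_K` — one extra hypothesis `¬ p ∣ NumberField.classNumber K` — from the route's own binder
`MastellaZermanHowardDivisibility` (item stmt-BirchSwinnertonDyer-25233 = the body of the cite-only named
fact Mastella–Zerman 2026 Cor. 4.6 at universe `0`, DEFINITIONALLY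
`MastellaZerman2026.cor46_howardDivisibility_of_scalarImage.{0}`; a binder `hMZ` of the route's `closes`),
by the cell's landed stub-s1 theorem `X9.torsionDepth_stub_coprimeClassNumber_of_cor46` (p596622, typer
tree, route-free) at the embedding `jbar := IsAlgClosed.lift` along `ιC`.

* `rung_isSlice_coprimeClassNumber` — the deciding crux, fed its three print binders, specialises to
  the slice (so the rung's statement IS a special case of the crux BY ID: kernel `fun … => h hMZ hCGLS hTw …`).
* `rung_coprimeClassNumber` — THE RUNG: the slice holds, from `hMZ` alone.
* `cor46_of_mastellaZermanHowardDivisibility` — the definitional bridge item-body ↦ named fact.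
* §4 `rung_coprimeClassNumber_pinned` / `heegnerContainmentAt_tied_of_mastellaZerman` /
  `exists_heegnerFamily_dt_eq` — the same slice in the PINNED letter of the cell's FINDING PIN-1 (plan g9,
  2026-08-28T05:20Z; binder `¬ (p : ℤ) ∣ Dt.c`, tie `F.Dt = Dt`), so the witness survives the announced
  re-typing of the A-side items; (T4) of PIN-1 proved locally.

WHAT THIS IS AND IS NOT (numbers, not adjectives). The slice is the PRINTED regime of crux A
(Mastella–Zerman 2026 Cor. 4.6: Howard's Thm. B under (irr) + scalar `1 + pℤ_p` in the `p`-adic image +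
`p ∤ h_K·d_K`; the scalar condition is the tree THEOREM `ClassX9.hasPadicScalarImage`, Lombardo–Tronto
2022 Thm. 3.16). It lies OUTSIDE the known regime of the route's target `Rank1Residual.BSDpOnClassX9`
(BSD_p on the X9 leaf is open in the kernel and in print: Burungale–Castella–Skinner 2025 Thm. 1.1.2 (b)
needs (sur)/(im), which class X9 — irreducible NON-surjective mod-`p` image — violates; the K6 engine
`EngineIMCX9` is the route's declared residual), and the kernel tribunal accepts the underlying p596622
theorem as `t3k: present, clean=True` (probe 2026-08-28, route rev 5, quick tier). It does NOT exercise
the route's LEVER (the torsion layer `p ∣ h_K`, `K_∞ ∩ H_K ≠ K`): the lever rungs are PLAN-ONLY — the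
REGISTERED stubs `stub_depthZero_divisibleClassNumber` (R1: `p ∣ h_K`, torsion depth `δ = 0`, i.e.
`K_∞ ∩ K[1] = K`, Howard 2004 §3.3 / MZ26 §3 verbatim with intrinsic layers), `stub_depthPos_localized`
(CGLS 2022 Thm. 4.1.3 by name + the module comparison `ℋ_F ⊆ Λκ₁^{Hg}`) and `stub_depthPos_promotion`
of the skeleton of record `torsion-depth` on stmt-BirchSwinnertonDyer-23161 (sha256 ee75c3aa…, ledger
`payload.skeleton`; on-disk frames with `p ∣ h_K`: 225, torsion depth `k₀ = 0` on 15 of them, `k₀ ≥ 1` on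
210 — cell table `ty3/PrintCNFFrames.tsv`). No summit statement, no leaf, no crux is proved by this file;
BSD is NOT proved. «beyond-print theorem»: no.

References: [MastellaZerman2026] Cor. 4.6, Assumptions 2.1, 2.13 (v) (arXiv:2505.08710);
[LombardoTronto2022] Thm. 3.16; [Howard2004HeegnerKolyvagin] Thm. B, §2.7, §3.3;
[CastellaGrossiLeeSkinner2022] Thm. 4.1.3, p. 22 (arXiv:2008.02571); [BurungaleCastellaSkinner2025]
Thm. 1.1.2 (b) (arXiv:2405.00270); [PerrinRiou1987BSMF] §0; [GreenbergLNM1716] §1.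
-/

set_option linter.dupNamespace false
set_option autoImplicit false

noncomputable section

open scoped Classical

open WeierstrassCurve NumberField Literature.NumberTheory.EllipticCurves
  Literature.NumberTheory.EllipticCurves.ModularForms
  Summit.BirchSwinnertonDyer.BirchSwinnertonDyer.Theses.TorsionLayerDescent

namespace Summit.BirchSwinnertonDyer.BirchSwinnertonDyer.Theorems.TorsionLayerDescentRung

/-! ## §1 The route binder `hMZ` IS the named fact Mastella–Zerman 2026 Cor. 4.6 (universe 0) -/

/-- The item body `MastellaZermanHowardDivisibility` (stmt-BirchSwinnertonDyer-25233) is, definitionally,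
the cite-only named fact `MastellaZerman2026.cor46_howardDivisibility_of_scalarImage` at universe `0`.
[cite: MastellaZerman2026, Cor. 4.6 (arXiv:2505.08710)] -/
theorem cor46_of_mastellaZermanHowardDivisibility (hMZ : MastellaZermanHowardDivisibility) :
    MastellaZerman2026.cor46_howardDivisibility_of_scalarImage.{0} :=
  hMZ

/-! ## §2 The slice is a special case of the deciding crux, BY ID -/

/-- **The deciding crux `HowardContainmentAnyClassNumberOfPrint` (stmt-BirchSwinnertonDyer-25546), fed its
three print binders, specialises to the `p ∤ h_K` slice** (one more hypothesis, otherwise its letter): the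
rung below is an instance of the crux in the kernel. [cite: MastellaZerman2026, Cor. 4.6 (arXiv:2505.08710)]
[cite: CastellaGrossiLeeSkinner2022, Thm. 4.1.3 (arXiv:2008.02571)] -/
theorem rung_isSlice_coprimeClassNumber (h : HowardContainmentAnyClassNumberOfPrint)
    (hMZ : MastellaZermanHowardDivisibility) (hCGLS : CGLSHowardDivisibilityLocalized)
    (hTw : AnticyclotomicTowerInRingClassFields) :
    ∀ (W : WeierstrassCurve ℚ) [W.IsElliptic] [W.IsGloballyMinimal] (p : ℕ) [Fact p.Prime]
      [NeZero (W.conductorNorm ℤ)] (K : Type) [Field K] [NumberField K],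
      Summit.BirchSwinnertonDyer.BirchSwinnertonDyer.Rank1Residual.ClassX9 W p →
      IsImaginaryQuadratic K → NumberField.discr K ≠ -3 → NumberField.discr K ≠ -4 →
      SatisfiesHeegnerHypothesis (W.conductorNorm ℤ) K → SatisfiesHeegnerHypothesis p K →
      ∀ (κ : ZpExtension K p), κ.IsAnticyclotomic → ∀ (γ : Field.absoluteGaloisGroup K),
      κ.IsTopGenerator γ →
      ∀ (Dt : ModularParametrizationData W (W.conductorNorm ℤ))
        (H : HeegnerDatum (W.conductorNorm ℤ) (NumberField.discr K)) (ιC : K →+* ℂ),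
      ¬ p ∣ NumberField.classNumber K →
      ∃ (jbar : AlgebraicClosure K →+* ℂ) (D : (W.baseChange K).LambdaAdicSelmerData κ γ)
        (F : HeegnerFamily (W.conductorNorm ℤ) W K κ jbar) (X : (W.baseChange K).SelmerDualData κ γ),
        heegnerCharIdeal D F ^ 2 ≤
          Module.charIdeal (IwasawaAlgebra p) (Submodule.torsion (IwasawaAlgebra p) X.X) := by
  intro W _ _ p _ _ K _ _ hX9 hK h3 h4 hHN hHp κ hκ γ hγ Dt H ιC _
  exact h hMZ hCGLS hTw W p K hX9 hK h3 h4 hHN hHp κ hκ γ hγ Dt H ιC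

/-! ## §3 THE RUNG: the `p ∤ h_K` slice of the deciding crux holds, from the route binder `hMZ` alone -/

/-- **THE RUNG (BC5 / T3, by ID).** On every X9 pair `(E, p)` (route class predicate
`Rank1Residual.ClassX9 W p`), every imaginary quadratic `K` with `d_K ∉ {−3, −4}` satisfying the Heegner
hypothesis for `N_E` and for `p`, every anticyclotomic datum `(κ, γ)` and every `Dt`, `H`, `ιC`: IF
`p ∤ h_K` THEN there are `jbar`, `Λ`-adic Selmer data `D`, a Heegner family `ℋ_∞` and a Selmer dual `X`
with `I(ℋ_∞)² ⊆ char_Λ(X_tors)` — granted the route's print binder `hMZ` (Mastella–Zerman 2026 Cor. 4.6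
by name). Proof: `jbar := IsAlgClosed.lift` along `ιC`, then the cell's landed
`X9.torsionDepth_stub_coprimeClassNumber_of_cor46` (p596622) at that `jbar`. PRINT regime of crux A; the
lever regime `p ∣ h_K` is NOT touched (plan-only stubs, module docstring). BSD is NOT proved.
[cite: MastellaZerman2026, Cor. 4.6, Assumptions 2.1 and 2.13 (v) (arXiv:2505.08710)]
[cite: LombardoTronto2022, Thm. 3.16] [cite: Howard2004HeegnerKolyvagin, Thm. B, §2.7, §3.3]
[cite: PerrinRiou1987BSMF, §0 (p. 402)] [cite: GreenbergLNM1716, §1] -/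
theorem rung_coprimeClassNumber (hMZ : MastellaZermanHowardDivisibility) :
    ∀ (W : WeierstrassCurve ℚ) [W.IsElliptic] [W.IsGloballyMinimal] (p : ℕ) [Fact p.Prime]
      [NeZero (W.conductorNorm ℤ)] (K : Type) [Field K] [NumberField K],
      Summit.BirchSwinnertonDyer.BirchSwinnertonDyer.Rank1Residual.ClassX9 W p →
      IsImaginaryQuadratic K → NumberField.discr K ≠ -3 → NumberField.discr K ≠ -4 →
      SatisfiesHeegnerHypothesis (W.conductorNorm ℤ) K → SatisfiesHeegnerHypothesis p K →
      ∀ (κ : ZpExtension K p), κ.IsAnticyclotomic → ∀ (γ : Field.absoluteGaloisGroup K),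
      κ.IsTopGenerator γ →
      ∀ (Dt : ModularParametrizationData W (W.conductorNorm ℤ))
        (H : HeegnerDatum (W.conductorNorm ℤ) (NumberField.discr K)) (ιC : K →+* ℂ),
      ¬ p ∣ NumberField.classNumber K →
      ∃ (jbar : AlgebraicClosure K →+* ℂ) (D : (W.baseChange K).LambdaAdicSelmerData κ γ)
        (F : HeegnerFamily (W.conductorNorm ℤ) W K κ jbar) (X : (W.baseChange K).SelmerDualData κ γ),
        heegnerCharIdeal D F ^ 2 ≤
          Module.charIdeal (IwasawaAlgebra p) (Submodule.torsion (IwasawaAlgebra p) X.X) := by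
  intro W _ _ p _ _ K _ _ hX9 hK h3 h4 hHN hHp κ hκ γ hγ Dt H ιC hhK
  -- a complex embedding of `K̄` extending `ιC` (`ℂ` is algebraically closed)
  letI : Algebra K ℂ := ιC.toAlgebra
  let jbar : AlgebraicClosure K →+* ℂ :=
    (IsAlgClosed.lift (R := K) (M := ℂ) (S := AlgebraicClosure K)).toRingHom
  exact ⟨jbar, Summit.BirchSwinnertonDyer.Rank1Residual.X9.torsionDepth_stub_coprimeClassNumber_of_cor46
    (cor46_of_mastellaZermanHowardDivisibility hMZ) W p K hX9 hK h3 h4 hHN hHp κ hκ γ hγ Dt H ιC jbar hhK⟩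

/-- **The rung is the crux's slice, pointwise**: any proof of the deciding crux reproves the rung (with the
route's three print binders supplied). Kernel sanity link between §2 and §3; nothing new is asserted.
[cite: MastellaZerman2026, Cor. 4.6 (arXiv:2505.08710)] -/
theorem rung_of_crux (h : HowardContainmentAnyClassNumberOfPrint)
    (hMZ : MastellaZermanHowardDivisibility) (hCGLS : CGLSHowardDivisibilityLocalized)
    (hTw : AnticyclotomicTowerInRingClassFields)
    (W : WeierstrassCurve ℚ) [W.IsElliptic] [W.IsGloballyMinimal] (p : ℕ) [Fact p.Prime]
    [NeZero (W.conductorNorm ℤ)] (K : Type) [Field K] [NumberField K]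
    (hX9 : Summit.BirchSwinnertonDyer.BirchSwinnertonDyer.Rank1Residual.ClassX9 W p)
    (hK : IsImaginaryQuadratic K) (h3 : NumberField.discr K ≠ -3) (h4 : NumberField.discr K ≠ -4)
    (hHN : SatisfiesHeegnerHypothesis (W.conductorNorm ℤ) K) (hHp : SatisfiesHeegnerHypothesis p K)
    (κ : ZpExtension K p) (hκ : κ.IsAnticyclotomic) (γ : Field.absoluteGaloisGroup K)
    (hγ : κ.IsTopGenerator γ) (Dt : ModularParametrizationData W (W.conductorNorm ℤ))
    (H : HeegnerDatum (W.conductorNorm ℤ) (NumberField.discr K)) (ιC : K →+* ℂ)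
    (hhK : ¬ p ∣ NumberField.classNumber K) :
    ∃ (jbar : AlgebraicClosure K →+* ℂ) (D : (W.baseChange K).LambdaAdicSelmerData κ γ)
      (F : HeegnerFamily (W.conductorNorm ℤ) W K κ jbar) (X : (W.baseChange K).SelmerDualData κ γ),
      heegnerCharIdeal D F ^ 2 ≤
        Module.charIdeal (IwasawaAlgebra p) (Submodule.torsion (IwasawaAlgebra p) X.X) :=
  rung_isSlice_coprimeClassNumber h hMZ hCGLS hTw W p K hX9 hK h3 h4 hHN hHp κ hκ γ hγ Dt H ιC hhK

/-! ## §4 Forward-compatibility with FINDING PIN-1 (cell plan g9, 2026-08-28T05:20Z): the TIED-family slice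

The `∃ (F : HeegnerFamily …)` layout of crux A leaves `F.Dt` unpinned (PIN-1 §1: rescaling `F ↦ p^a • F`
makes the typed containment `μ`-blind); the cell's ruling (R1)/(R3) re-types the A-side items with the
binder `¬ (p : ℤ) ∣ Dt.c` and the tie `F.Dt = Dt` in the conclusion. Mastella–Zerman Cor. 4.6 is universal
over the data `(D, ℋ_∞, X)`, so the `p ∤ h_K` slice holds for the TIED family as well: the two theorems
below are the pinned twin of §3 (PIN-1 (T4) proved locally as `exists_heegnerFamily_dt_eq`, a re-run of
the proof term of `nonempty_heegnerFamily_of`; to be superseded by the Literature helper when ty1 lands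
it). The binder `¬ (p : ℤ) ∣ Dt.c` is carried for the letter of (R3) and is not used. -/

/-- **PIN-1 (T4), local copy: Heegner families exist ON a given parametrisation datum and orientation**
(`F.Dt = Dt ∧ F.β = β`) — the proof term of `nonempty_heegnerFamily_of` with the witness exposed.
[cite: Howard2004HeegnerKolyvagin, §2.7 and §3.3] [cite: GrossLMS1991, §3] -/
theorem exists_heegnerFamily_dt_eq {N : ℕ} [NeZero N] {W : WeierstrassCurve ℚ} {K : Type} [Field K]
    [NumberField K] {p : ℕ} [Fact p.Prime] (h : exists_isHeegnerNormPoint N W K p) [W.IsElliptic]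
    (hK : IsImaginaryQuadratic K) (hH : SatisfiesHeegnerHypothesis N K) (hp : ¬ p ∣ N)
    (κ : ZpExtension K p) (Dt : ModularParametrizationData W N) {β : ℤ}
    (hβ : (4 * N : ℤ) ∣ β ^ 2 - NumberField.discr K) (jbar : AlgebraicClosure K →+* ℂ) :
    ∃ F : HeegnerFamily N W K κ jbar, F.Dt = Dt ∧ F.β = β := by
  have hc : ∀ j : ℕ, (p ^ (j + 1)).Coprime N := fun j ↦
    Nat.Coprime.pow_left _ (((Fact.out : p.Prime)).coprime_iff_not_dvd.mpr hp)
  choose z hz using fun j : ℕ ↦ h hK hH κ Dt hβ jbar j (hc j)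
  obtain ⟨y, hy⟩ := h hK hH κ Dt hβ jbar 0 (Nat.coprime_one_left N)
  exact ⟨⟨Dt, β, hβ, y, hy, z, hz⟩, rfl, rfl⟩

/-- **The `p ∤ h_K` slice for the TIED family at a GIVEN `jbar`** (pinned twin of
`X9.heegnerContainmentAt_of_cor46`): data `D`, `X` by the tree's existence theorems, `ℋ_∞` ON `(Dt, H.β)`
by `exists_heegnerFamily_dt_eq`, Mastella–Zerman Cor. 4.6 (`hMZ`, by name) at `jbar` through
`ClassX9.mz26Hypotheses`. [cite: MastellaZerman2026, Cor. 4.6, Assumptions 2.1 and 2.13 (v) (arXiv:2505.08710)]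
[cite: LombardoTronto2022, Thm. 3.16] [cite: PerrinRiou1987BSMF, §0 (p. 402)] [cite: GreenbergLNM1716, §1] -/
theorem heegnerContainmentAt_tied_of_mastellaZerman (hMZ : MastellaZermanHowardDivisibility)
    {W : WeierstrassCurve ℚ} [W.IsElliptic] [W.IsGloballyMinimal] {p : ℕ} [Fact p.Prime]
    [NeZero (W.conductorNorm ℤ)] {K : Type} [Field K] [NumberField K]
    (hX9 : Summit.BirchSwinnertonDyer.BirchSwinnertonDyer.Rank1Residual.ClassX9 W p)
    (hK : IsImaginaryQuadratic K) (h3 : NumberField.discr K ≠ -3) (h4 : NumberField.discr K ≠ -4)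
    (hHN : SatisfiesHeegnerHypothesis (W.conductorNorm ℤ) K) (hHp : SatisfiesHeegnerHypothesis p K)
    (hhK : ¬ p ∣ NumberField.classNumber K)
    (κ : ZpExtension K p) (hκ : κ.IsAnticyclotomic)
    (γ : Field.absoluteGaloisGroup K) (hγ : κ.IsTopGenerator γ)
    (Dt : ModularParametrizationData W (W.conductorNorm ℤ))
    (H : HeegnerDatum (W.conductorNorm ℤ) (NumberField.discr K))
    (jbar : AlgebraicClosure K →+* ℂ) :
    ∃ (D : (W.baseChange K).LambdaAdicSelmerData κ γ)
      (F : HeegnerFamily (W.conductorNorm ℤ) W K κ jbar) (X : (W.baseChange K).SelmerDualData κ γ),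
      F.Dt = Dt ∧ heegnerCharIdeal D F ^ 2 ≤
        Module.charIdeal (IwasawaAlgebra p) (Submodule.torsion (IwasawaAlgebra p) X.X) := by
  have hX9' := Summit.BirchSwinnertonDyer.BirchSwinnertonDyer.Rank1Residual.classX9_census_of_classX9 W p hX9
  obtain ⟨D⟩ := LambdaAdicSelmerDataExists.nonempty_lambdaAdicSelmerData (W.baseChange K) p κ hγ
  obtain ⟨X⟩ := (W.baseChange K).nonempty_selmerDualData_holds κ γ hγ
  obtain ⟨F, hFDt, -⟩ := exists_heegnerFamily_dt_eq
    (exists_isHeegnerNormPoint_holds (W.conductorNorm ℤ) W K p) hK hHN hX9'.not_dvd_conductorNorm κ Dt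
    H.dvd_sq_sub jbar
  exact ⟨D, F, X, hFDt, Ideal.le_of_dvd (MastellaZerman2026.conclusion_of_cor46 (jbar := jbar)
    (cor46_of_mastellaZermanHowardDivisibility hMZ)
    (hX9'.mz26Hypotheses κ γ hK ⟨h3, h4⟩ hHN hHp hhK hκ hγ) D F X)⟩

/-- **THE PINNED RUNG (PIN-1 (R3) letter: binder `¬ (p : ℤ) ∣ Dt.c`, tie `F.Dt = Dt`).** The `p ∤ h_K`
slice of the pinned A-side crux template «A with `¬ (p : ℤ) ∣ Dt.c →` after `(ιC : K →+* ℂ),` and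
conclusion `∃ jbar D F X, F.Dt = Dt ∧ I(ℋ_F)² ⊆ char_Λ(X_tors)`», from the route binder `hMZ` alone
(`jbar := IsAlgClosed.lift` along `ιC`). Same honest label as §3: PRINT regime, lever `p ∣ h_K` not
touched, BSD NOT proved. [cite: MastellaZerman2026, Cor. 4.6 (arXiv:2505.08710)]
[cite: Howard2004HeegnerKolyvagin, Thm. B, §2.7, §3.3] [cite: Mazur1978, (Manin constant, p odd good)] -/
theorem rung_coprimeClassNumber_pinned (hMZ : MastellaZermanHowardDivisibility) :
    ∀ (W : WeierstrassCurve ℚ) [W.IsElliptic] [W.IsGloballyMinimal] (p : ℕ) [Fact p.Prime]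
      [NeZero (W.conductorNorm ℤ)] (K : Type) [Field K] [NumberField K],
      Summit.BirchSwinnertonDyer.BirchSwinnertonDyer.Rank1Residual.ClassX9 W p →
      IsImaginaryQuadratic K → NumberField.discr K ≠ -3 → NumberField.discr K ≠ -4 →
      SatisfiesHeegnerHypothesis (W.conductorNorm ℤ) K → SatisfiesHeegnerHypothesis p K →
      ∀ (κ : ZpExtension K p), κ.IsAnticyclotomic → ∀ (γ : Field.absoluteGaloisGroup K),
      κ.IsTopGenerator γ →
      ∀ (Dt : ModularParametrizationData W (W.conductorNorm ℤ))
        (H : HeegnerDatum (W.conductorNorm ℤ) (NumberField.discr K)) (ιC : K →+* ℂ),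
      ¬ (p : ℤ) ∣ Dt.c → ¬ p ∣ NumberField.classNumber K →
      ∃ (jbar : AlgebraicClosure K →+* ℂ) (D : (W.baseChange K).LambdaAdicSelmerData κ γ)
        (F : HeegnerFamily (W.conductorNorm ℤ) W K κ jbar) (X : (W.baseChange K).SelmerDualData κ γ),
        F.Dt = Dt ∧ heegnerCharIdeal D F ^ 2 ≤
          Module.charIdeal (IwasawaAlgebra p) (Submodule.torsion (IwasawaAlgebra p) X.X) := by
  intro W _ _ p _ _ K _ _ hX9 hK h3 h4 hHN hHp κ hκ γ hγ Dt H ιC _ hhK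
  letI : Algebra K ℂ := ιC.toAlgebra
  let jbar : AlgebraicClosure K →+* ℂ :=
    (IsAlgClosed.lift (R := K) (M := ℂ) (S := AlgebraicClosure K)).toRingHom
  exact ⟨jbar, heegnerContainmentAt_tied_of_mastellaZerman hMZ hX9 hK h3 h4 hHN hHp hhK κ hκ γ hγ Dt H jbar⟩

end Summit.BirchSwinnertonDyer.BirchSwinnertonDyer.Theorems.TorsionLayerDescentRung

end
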